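import Mathlib

/-!
# Crux `DlogGraphFlat` (stmt-QuantumAdvantage-10732), line `Sketch` — sector A, stub S1a:
# the Glibichuk–Konyagin quotient-set dichotomy (`stub_dlogGKDichotomy`)

For `A ⊆ 𝔽_p` with `2 ≤ |A|` and `|A|² < p` there are `a₁, …, a₆ ∈ A` with
`|A|² ≤ 2 · |a₁A − a₂A + a₃A − a₄A + a₅A − a₆A|` (dilates `aA`, iterated sum/difference sets).

Proof (Glibichuk–Konyagin, as in Garaev 2007 / Katz–Shen 2008; elementary). Let
`R = {(b₁ − b₂)/(a₁ − a₂) : aᵢ, bᵢ ∈ A, a₁ ≠ a₂}`, used only through the predicate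
"`b₁ − b₂ = ξ (a₁ − a₂)` for some `a₁ ≠ a₂, b₁, b₂ ∈ A`"; `0 ∈ R` as `|A| ≥ 2`.
* If `η ∉ R` then `(x, y) ↦ x + η y` is injective on `A × A`, so `|A + ηA| ≥ |A|²`
  (`dlogGK_card_le_card_add_smul`).
* Dilating by `a₁ − a₂ ≠ 0` embeds `A + ξA` into `a₁A − a₂A + b₁A − b₂A + a₅A − a₆A` whenever
  `(a₁ − a₂) ξ = (b₁ − b₂) + (a₅ − a₆)` (`dlogGK_card_add_smul_le`).
* If `R ≠ 𝔽_p`: `𝔽_p` is generated by `1` and `0 ∈ R`, so some `ξ ∈ R` has `ξ + 1 ∉ R`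
  (`dlogGK_exists_step`); with `ξ = (b₁ − b₂)/(a₁ − a₂)` the two facts above give
  `|A|² ≤ |A + (ξ + 1)A| ≤ |a₁A − a₂A + b₁A − b₂A + a₁A − a₂A|`.
* If `R = 𝔽_p`: the number `r(ξ)` of quadruples `a₁ ≠ a₂, b₁, b₂ ∈ A` with
  `b₁ − b₂ = ξ(a₁ − a₂)` sums over `ξ` to at most `|A|⁴ ≤ |A|² (p − 1)` (`dlogGK_sum_fiber_le`),
  so some `ξ ≠ 0` has `r(ξ) ≤ |A|²` (`dlogGK_exists_small_fiber`); the additive energy obeys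
  `E[A, ξA] ≤ |A|² + r(ξ) ≤ 2|A|²` (`dlogGK_addEnergy_le`), so Cauchy–Schwarz
  (`Finset.le_card_add_mul_addEnergy`) gives `|A|² ≤ 2 |A + ξA|`, and as `ξ ∈ R` the dilation
  embeds `A + ξA` into `a₁A − a₂A + b₁A − b₂A + a₁A − a₁A`.
-/

set_option linter.dupNamespace false -- D-0017: single-problem summit ⇒ `QuantumAdvantage.QuantumAdvantage` by design

namespace Summit.QuantumAdvantage.QuantumAdvantage.Theorems.SymplecticPurity

open Finset
open scoped Pointwise Combinatorics.Additive

section GKDichotomy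

variable {p : ℕ} [Fact p.Prime]

/-- If `η` is not a quotient `(b₁ - b₂)/(a₁ - a₂)` of differences from `A` (`a₁ ≠ a₂`), then
`(x, y) ↦ x + η y` is injective on `A × A`, so `|A + η • A| ≥ |A|²`. -/
theorem dlogGK_card_le_card_add_smul {A : Finset (ZMod p)} {η : ZMod p}
    (hη : ¬ ∃ a₁ ∈ A, ∃ a₂ ∈ A, ∃ b₁ ∈ A, ∃ b₂ ∈ A, a₁ ≠ a₂ ∧ b₁ - b₂ = η * (a₁ - a₂)) :
    #A * #A ≤ #(A + η • A) := by
  rw [← card_product]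
  refine card_le_card_of_injOn (fun xy => xy.1 + η * xy.2) ?_ ?_
  · intro xy hxy
    simp only [mem_coe, mem_product] at hxy
    exact mem_coe.2 (add_mem_add hxy.1 (smul_mem_smul_finset hxy.2))
  · intro xy hxy xy' hxy' h
    simp only [mem_coe, mem_product] at hxy hxy'
    have h : xy.1 + η * xy.2 = xy'.1 + η * xy'.2 := h
    by_contra hne
    by_cases h2 : xy.2 = xy'.2
    · exact hne (Prod.ext (by rw [h2] at h; exact add_right_cancel h) h2)
    · exact hη ⟨xy'.2, hxy'.2, xy.2, hxy.2, xy.1, hxy.1, xy'.1, hxy'.1, fun e => h2 e.symm,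
        by linear_combination h⟩

/-- Dilating by `a₁ - a₂ ≠ 0` embeds `A + ξ • A` into `a₁A − a₂A + b₁A − b₂A + a₅A − a₆A`
whenever `(a₁ − a₂) ξ = (b₁ − b₂) + (a₅ − a₆)`:
`(a₁ − a₂)(x + ξ y) = a₁x − a₂x + b₁y − b₂y + a₅y − a₆y`. -/
theorem dlogGK_card_add_smul_le {A : Finset (ZMod p)} {ξ a₁ a₂ b₁ b₂ a₅ a₆ : ZMod p}
    (hne : a₁ ≠ a₂) (hq : (a₁ - a₂) * ξ = (b₁ - b₂) + (a₅ - a₆)) :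
    #(A + ξ • A) ≤ #(a₁ • A - a₂ • A + b₁ • A - b₂ • A + a₅ • A - a₆ • A) := by
  refine card_le_card_of_injOn (fun z => (a₁ - a₂) * z) ?_
    (mul_right_injective₀ (sub_ne_zero.2 hne)).injOn
  intro z hz
  rw [mem_coe] at hz
  obtain ⟨x, hx, u, hu, rfl⟩ := mem_add.1 hz
  obtain ⟨y, hy, rfl⟩ := mem_smul_finset.1 hu
  have hmem : a₁ • x - a₂ • x + b₁ • y - b₂ • y + a₅ • y - a₆ • y ∈
      a₁ • A - a₂ • A + b₁ • A - b₂ • A + a₅ • A - a₆ • A :=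
    sub_mem_sub (add_mem_add (sub_mem_sub (add_mem_add (sub_mem_sub (smul_mem_smul_finset hx)
      (smul_mem_smul_finset hx)) (smul_mem_smul_finset hy)) (smul_mem_smul_finset hy))
      (smul_mem_smul_finset hy)) (smul_mem_smul_finset hy)
  rw [mem_coe]
  convert hmem using 1
  simp only [smul_eq_mul]
  linear_combination y * hq

/-- Discrete continuity in `ZMod p`: a property holding at `0` but not everywhere is not preserved
by `ξ ↦ ξ + 1` at some point (every residue is an iterated successor of `0`). -/
theorem dlogGK_exists_step {P : ZMod p → Prop} (h0 : P 0) (h : ¬ ∀ ξ, P ξ) :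
    ∃ ξ, P ξ ∧ ¬ P (ξ + 1) := by
  by_contra hcon
  apply h
  have hstep : ∀ ξ, P ξ → P (ξ + 1) := fun ξ hξ => by_contra fun hn => hcon ⟨ξ, hξ, hn⟩
  have hnat : ∀ k : ℕ, P (k : ZMod p) := by
    intro k
    induction k with
    | zero => simpa only [Nat.cast_zero] using h0
    | succ k ih => simpa only [Nat.cast_succ] using hstep _ ih
  intro ξ
  simpa only [ZMod.natCast_zmod_val] using hnat ξ.val

/-- Each quadruple `(a₁, a₂, b₁, b₂) ∈ A⁴` with `a₁ ≠ a₂` satisfies `b₁ − b₂ = ξ(a₁ − a₂)` for at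
most one `ξ`, so these counts sum over `ξ ∈ 𝔽_p` to at most `|A|⁴`. -/
theorem dlogGK_sum_fiber_le (A : Finset (ZMod p)) :
    ∑ ξ : ZMod p, #{q ∈ (A ×ˢ A) ×ˢ (A ×ˢ A) |
        q.1.1 ≠ q.1.2 ∧ q.2.1 - q.2.2 = ξ * (q.1.1 - q.1.2)} ≤ (#A * #A) * (#A * #A) := by
  have hdisj : (↑(univ : Finset (ZMod p)) : Set (ZMod p)).PairwiseDisjoint fun ξ =>
      {q ∈ (A ×ˢ A) ×ˢ (A ×ˢ A) | q.1.1 ≠ q.1.2 ∧ q.2.1 - q.2.2 = ξ * (q.1.1 - q.1.2)} := by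
    intro ξ _ ξ' _ hne
    exact disjoint_left.2 fun q hq hq' => hne (mul_right_cancel₀ (sub_ne_zero.2 (mem_filter.1 hq).2.1)
      ((mem_filter.1 hq).2.2.symm.trans (mem_filter.1 hq').2.2))
  calc ∑ ξ : ZMod p, #{q ∈ (A ×ˢ A) ×ˢ (A ×ˢ A) |
          q.1.1 ≠ q.1.2 ∧ q.2.1 - q.2.2 = ξ * (q.1.1 - q.1.2)}
      = #((univ : Finset (ZMod p)).biUnion fun ξ =>
          {q ∈ (A ×ˢ A) ×ˢ (A ×ˢ A) | q.1.1 ≠ q.1.2 ∧ q.2.1 - q.2.2 = ξ * (q.1.1 - q.1.2)}) :=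
        (card_biUnion hdisj).symm
    _ ≤ #((A ×ˢ A) ×ˢ (A ×ˢ A)) := card_le_card (biUnion_subset.2 fun ξ _ => filter_subset _ _)
    _ = (#A * #A) * (#A * #A) := by rw [card_product, card_product]

/-- Averaging: if `|A|² < p`, some `ξ ≠ 0` has at most `|A|²` quadruples `a₁ ≠ a₂, b₁, b₂ ∈ A`
with `b₁ − b₂ = ξ(a₁ − a₂)` (the counts sum to `≤ |A|⁴ ≤ |A|² (p − 1)` over the `p − 1`
non-zero residues). -/
theorem dlogGK_exists_small_fiber (A : Finset (ZMod p)) (hAp : #A * #A < p) :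
    ∃ ξ : ZMod p, ξ ≠ 0 ∧
      #{q ∈ (A ×ˢ A) ×ˢ (A ×ˢ A) | q.1.1 ≠ q.1.2 ∧ q.2.1 - q.2.2 = ξ * (q.1.1 - q.1.2)} ≤
        #A * #A := by
  have hscard : #((univ : Finset (ZMod p)).erase 0) = p - 1 := by
    rw [card_erase_of_mem (mem_univ _), card_univ, ZMod.card]
  have hsne : ((univ : Finset (ZMod p)).erase 0).Nonempty :=
    ⟨1, mem_erase.2 ⟨one_ne_zero, mem_univ _⟩⟩
  have hsum : ∑ ξ ∈ (univ : Finset (ZMod p)).erase 0, #{q ∈ (A ×ˢ A) ×ˢ (A ×ˢ A) |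
        q.1.1 ≠ q.1.2 ∧ q.2.1 - q.2.2 = ξ * (q.1.1 - q.1.2)} ≤
      ∑ _ξ ∈ (univ : Finset (ZMod p)).erase 0, #A * #A :=
    calc ∑ ξ ∈ (univ : Finset (ZMod p)).erase 0, #{q ∈ (A ×ˢ A) ×ˢ (A ×ˢ A) |
            q.1.1 ≠ q.1.2 ∧ q.2.1 - q.2.2 = ξ * (q.1.1 - q.1.2)}
        ≤ ∑ ξ : ZMod p, #{q ∈ (A ×ˢ A) ×ˢ (A ×ˢ A) |
            q.1.1 ≠ q.1.2 ∧ q.2.1 - q.2.2 = ξ * (q.1.1 - q.1.2)} :=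
          sum_le_sum_of_subset_of_nonneg (erase_subset _ _) fun _ _ _ => Nat.zero_le _
      _ ≤ (#A * #A) * (#A * #A) := dlogGK_sum_fiber_le A
      _ ≤ (p - 1) * (#A * #A) := Nat.mul_le_mul_right _ (Nat.le_sub_one_of_lt hAp)
      _ = ∑ _ξ ∈ (univ : Finset (ZMod p)).erase 0, #A * #A := by
          rw [sum_const, smul_eq_mul, hscard]
  obtain ⟨ξ, hξs, hξ⟩ := exists_le_of_sum_le hsne hsum
  exact ⟨ξ, (mem_erase.1 hξs).1, hξ⟩

/-- Energy bound: `E[A, ξ • A] ≤ |A|² + r(ξ)`, where `r(ξ)` counts the quadruples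
`a₁ ≠ a₂, b₁, b₂ ∈ A` with `b₁ − b₂ = ξ (a₁ − a₂)`. Parametrising `ξ • A` by `A`, a solution of
`x + ξ y = x' + ξ y'` (`x, x', y, y' ∈ A`) either has `y = y'` (hence `x = x'`; at most `|A|²`
of them) or yields the quadruple `(y', y, x, x')`. -/
theorem dlogGK_addEnergy_le (A : Finset (ZMod p)) (ξ : ZMod p) :
    E[A, ξ • A] ≤ #A * #A + #{q ∈ (A ×ˢ A) ×ˢ (A ×ˢ A) |
      q.1.1 ≠ q.1.2 ∧ q.2.1 - q.2.2 = ξ * (q.1.1 - q.1.2)} := by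
  -- the solution set parametrised by `A⁴`
  set T : Finset ((ZMod p × ZMod p) × (ZMod p × ZMod p)) :=
    {w ∈ (A ×ˢ A) ×ˢ (A ×ˢ A) | w.1.1 + ξ * w.2.1 = w.1.2 + ξ * w.2.2} with hT
  have hE : E[A, ξ • A] ≤ #T := by
    unfold Finset.addEnergy
    refine card_le_card_of_surjOn (fun w => (w.1, (ξ * w.2.1, ξ * w.2.2))) ?_
    intro z hz
    simp only [mem_coe, mem_filter, mem_product] at hz
    obtain ⟨⟨⟨hx, hx'⟩, hu, hu'⟩, heq⟩ := hz
    obtain ⟨y, hy, hyu⟩ := mem_smul_finset.1 hu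
    obtain ⟨y', hy', hyu'⟩ := mem_smul_finset.1 hu'
    rw [smul_eq_mul] at hyu hyu'
    refine ⟨(z.1, (y, y')), ?_, ?_⟩
    · simp only [mem_coe, hT, mem_filter, mem_product]
      exact ⟨⟨⟨hx, hx'⟩, hy, hy'⟩, by rw [hyu, hyu']; exact heq⟩
    · show (z.1, (ξ * y, ξ * y')) = z
      rw [hyu, hyu']
  have hsplit := card_filter_add_card_filter_not (s := T) (fun w => w.2.1 = w.2.2)
  have h1 : #(T.filter fun w => w.2.1 = w.2.2) ≤ #A * #A := by
    rw [← card_product]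
    refine card_le_card_of_injOn (fun w => (w.1.1, w.2.1)) ?_ ?_
    · intro w hw
      simp only [mem_coe, hT, mem_filter, mem_product] at hw
      exact mem_coe.2 (mem_product.2 ⟨hw.1.1.1.1, hw.1.1.2.1⟩)
    · intro w hw w' hw' h
      simp only [mem_coe, hT, mem_filter, mem_product] at hw hw'
      have h : (w.1.1, w.2.1) = (w'.1.1, w'.2.1) := h
      simp only [Prod.mk.injEq] at h
      have e1 : w.1.1 = w.1.2 := by linear_combination hw.1.2 - ξ * hw.2
      have e1' : w'.1.1 = w'.1.2 := by linear_combination hw'.1.2 - ξ * hw'.2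
      exact Prod.ext (Prod.ext h.1 (e1.symm.trans (h.1.trans e1')))
        (Prod.ext h.2 (hw.2.symm.trans (h.2.trans hw'.2)))
  have h2 : #(T.filter fun w => ¬ w.2.1 = w.2.2) ≤ #{q ∈ (A ×ˢ A) ×ˢ (A ×ˢ A) |
      q.1.1 ≠ q.1.2 ∧ q.2.1 - q.2.2 = ξ * (q.1.1 - q.1.2)} := by
    refine card_le_card_of_injOn (fun w => ((w.2.2, w.2.1), (w.1.1, w.1.2))) ?_ ?_
    · intro w hw
      simp only [mem_coe, hT, mem_filter, mem_product] at hw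
      obtain ⟨⟨⟨⟨hx, hx'⟩, hy, hy'⟩, heq⟩, hne⟩ := hw
      simp only [mem_coe, mem_filter, mem_product]
      exact ⟨⟨⟨hy', hy⟩, hx, hx'⟩, fun e => hne e.symm, by linear_combination heq⟩
    · intro w _ w' _ h
      have h : ((w.2.2, w.2.1), (w.1.1, w.1.2)) = ((w'.2.2, w'.2.1), (w'.1.1, w'.1.2)) := h
      simp only [Prod.mk.injEq] at h
      exact Prod.ext (Prod.ext h.2.1 h.2.2) (Prod.ext h.1.2 h.1.1)
  calc E[A, ξ • A] ≤ #T := hE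
    _ = #(T.filter fun w => w.2.1 = w.2.2) + #(T.filter fun w => ¬ w.2.1 = w.2.2) := hsplit.symm
    _ ≤ _ := Nat.add_le_add h1 h2

end GKDichotomy

/-- **Stub S1a (sector A, the Glibichuk–Konyagin dichotomy).** For `A ⊆ 𝔽_p` with
`2 ≤ |A|` and `|A|² < p` there are `a₁, …, a₆ ∈ A` with
`|A|² ≤ 2 · |a₁A − a₂A + a₃A − a₄A + a₅A − a₆A|`. With `R = (A − A)/(A − A)` (non-zero
denominators): if `R ≠ 𝔽_p`, some `ξ = (b₁ − b₂)/(a₁ − a₂) ∈ R` has `ξ + 1 ∉ R`, whence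
`|A|² = |A + (ξ+1)A| ≤ |a₁A − a₂A + b₁A − b₂A + a₁A − a₂A|`; if `R = 𝔽_p`, an averaging over
`ξ ≠ 0`, the energy bound `E[A, ξA] ≤ 2|A|²` and Cauchy–Schwarz give `|A|² ≤ 2|A + ξA|` for some
`ξ = (b₁ − b₂)/(a₁ − a₂)`, and `|A + ξA| ≤ |a₁A − a₂A + b₁A − b₂A + a₁A − a₁A|`. -/
theorem stub_dlogGKDichotomy :
    ∀ (p : ℕ) [Fact (Nat.Prime p)] (A : Finset (ZMod p)), 2 ≤ A.card → A.card ^ 2 < p →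
      ∃ a₁ ∈ A, ∃ a₂ ∈ A, ∃ a₃ ∈ A, ∃ a₄ ∈ A, ∃ a₅ ∈ A, ∃ a₆ ∈ A,
        A.card ^ 2 ≤ 2 * (a₁ • A - a₂ • A + a₃ • A - a₄ • A + a₅ • A - a₆ • A).card := by
  intro p _ A hA hAp
  by_cases hR : ∀ ξ : ZMod p, ∃ a₁ ∈ A, ∃ a₂ ∈ A, ∃ b₁ ∈ A, ∃ b₂ ∈ A,
      a₁ ≠ a₂ ∧ b₁ - b₂ = ξ * (a₁ - a₂)
  · -- Case `R = 𝔽_p`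
    rw [sq] at hAp
    obtain ⟨ξ, hξ0, hfib⟩ := dlogGK_exists_small_fiber A hAp
    obtain ⟨a₁, ha₁, a₂, ha₂, b₁, hb₁, b₂, hb₂, hne, hq⟩ := hR ξ
    refine ⟨a₁, ha₁, a₂, ha₂, b₁, hb₁, b₂, hb₂, a₁, ha₁, a₁, ha₁, ?_⟩
    have hE : E[A, ξ • A] ≤ #A * #A + #A * #A :=
      (dlogGK_addEnergy_le A ξ).trans (Nat.add_le_add_left hfib _)
    have hpos : 0 < #A * #A := Nat.mul_pos (by omega) (by omega)
    have hmul : #A ^ 2 * (#A * #A) ≤ 2 * #(A + ξ • A) * (#A * #A) :=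
      calc #A ^ 2 * (#A * #A) = #A ^ 2 * #(ξ • A) ^ 2 := by rw [card_smul_finset₀ hξ0, sq]
        _ ≤ #(A + ξ • A) * E[A, ξ • A] := le_card_add_mul_addEnergy A (ξ • A)
        _ ≤ #(A + ξ • A) * (#A * #A + #A * #A) := Nat.mul_le_mul_left _ hE
        _ = 2 * #(A + ξ • A) * (#A * #A) := by ring
    calc #A ^ 2 ≤ 2 * #(A + ξ • A) := Nat.le_of_mul_le_mul_right hmul hpos
      _ ≤ 2 * #(a₁ • A - a₂ • A + b₁ • A - b₂ • A + a₁ • A - a₁ • A) :=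
        Nat.mul_le_mul_left 2 (dlogGK_card_add_smul_le hne (by linear_combination -hq))
  · -- Case `R ≠ 𝔽_p`
    have h0 : ∃ a₁ ∈ A, ∃ a₂ ∈ A, ∃ b₁ ∈ A, ∃ b₂ ∈ A,
        a₁ ≠ a₂ ∧ b₁ - b₂ = (0 : ZMod p) * (a₁ - a₂) := by
      obtain ⟨a, ha, b, hb, hab⟩ := one_lt_card.1 hA
      exact ⟨a, ha, b, hb, a, ha, a, ha, hab, by ring⟩
    obtain ⟨ξ, ⟨a₁, ha₁, a₂, ha₂, b₁, hb₁, b₂, hb₂, hne, hq⟩, hη⟩ :=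
      dlogGK_exists_step (P := fun ξ : ZMod p => ∃ a₁ ∈ A, ∃ a₂ ∈ A, ∃ b₁ ∈ A, ∃ b₂ ∈ A,
        a₁ ≠ a₂ ∧ b₁ - b₂ = ξ * (a₁ - a₂)) h0 hR
    refine ⟨a₁, ha₁, a₂, ha₂, b₁, hb₁, b₂, hb₂, a₁, ha₁, a₂, ha₂, ?_⟩
    calc #A ^ 2 = #A * #A := sq _
      _ ≤ #(A + (ξ + 1) • A) := dlogGK_card_le_card_add_smul hη
      _ ≤ #(a₁ • A - a₂ • A + b₁ • A - b₂ • A + a₁ • A - a₂ • A) :=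
        dlogGK_card_add_smul_le hne (by linear_combination -hq)
      _ ≤ 2 * #(a₁ • A - a₂ • A + b₁ • A - b₂ • A + a₁ • A - a₂ • A) :=
        Nat.le_mul_of_pos_left _ two_pos

end Summit.QuantumAdvantage.QuantumAdvantage.Theorems.SymplecticPurity
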